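import Mathlib.RingTheory.PowerSeries.Inverse
import Mathlib.LinearAlgebra.FreeModule.PID
import Mathlib.Algebra.Module.Torsion.Basic
import Mathlib.LinearAlgebra.Quotient.Basic
import Mathlib.RingTheory.Ideal.Quotient.Basic
import Mathlib.SetTheory.Cardinal.Finite
import Mathlib.Algebra.Field.ZMod
import Mathlib.RingTheory.Finiteness.Basic

/-!
# Residual Iwasawa algebra over `Ω = k⟦T⟧` (`k` a finite field): the ONE-LAYER FINITENESS CRITERION

Pure commutative algebra for the crux idea `residual-layer-criterion` on `TwinAlgMuZeroAtThree`
(stmt-BirchSwinnertonDyer-24254; card `Cruxes/TwinAlgMuZeroAtThree/Ideas/residual-layer-criterion.md`,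
stub S-B1 = `OmegaLayerCriterion` of `Cruxes/TwinAlgMuZeroAtThree/SketchUtdIdeaG52.lean` §B):

* `finite_of_X_pow_smul_eq_zero` — a finitely generated `k⟦T⟧`-module killed by `T ^ m` is finite;
* `finite_quotient_X_pow_smul_top` — hence `X ⧸ T^m X` is finite for every finitely generated `X`;
* `natCard_quotient_X_pow_smul_top_ge` — if `X` is NOT `k⟦T⟧`-torsion then `#(X ⧸ T^m X) ≥ #k ^ m`
  (a torsion-free quotient of positive rank surjects onto `Ω`, and `Ω ⧸ T^m ↠ k^m` by the first `m`
  coefficients);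
* `finite_of_natCard_quotient_lt` — THE CRITERION: `#(X ⧸ T^m X) < #k ^ m` for one `m` forces `X` to be
  torsion, hence (`Ω` a DVR with finite residue field) FINITE;
* `omegaLayerCriterion` — the `k = 𝔽₃`, `m = 3 ^ n` instance, literally the text of `OmegaLayerCriterion`.

Iwasawa-theoretic reading (the card): for `X = Sel(K_∞, E′[3])^∨` over `Ω = 𝔽₃⟦T⟧` with exact control
`X ⧸ T^{3^n} X = Sel(K_n, E′[3])^∨` (`ω_n = (1+T)^{3^n} - 1 = T^{3^n}` in characteristic `3`), ONE layer with
`dim_{𝔽₃} Sel(K_n, E′[3]) < 3^n` gives `X` finite, i.e. `μ = 0` and torsion for the `Λ`-dual. THEOREMS ONLY, no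
`sorry`, no named fact; nothing here mentions elliptic curves. References: Washington, GTM 83, §13.2 (structure of
finitely generated `Λ`-modules); the statements are folklore.
-/

set_option linter.dupNamespace false
set_option autoImplicit false

noncomputable section

open scoped Classical
open PowerSeries

namespace Summit.BirchSwinnertonDyer.BirchSwinnertonDyer.Theorems.UniversalToricDescentResidualLayerAlgebra

universe u v

variable {k : Type u} [Field k]

/-! ## §1 Division with remainder by `T ^ m` -/

/-- Division with remainder by `T ^ m`: `T ^ m` divides `f - ∑_{i<m} f_i T^i`. [folklore] -/
theorem X_pow_dvd_sub_mk_coeff (m : ℕ) (f : k⟦X⟧) :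
    (X : k⟦X⟧) ^ m ∣ f - PowerSeries.mk (fun i => if i < m then PowerSeries.coeff i f else 0) := by
  rw [PowerSeries.X_pow_dvd_iff]
  intro i hi
  simp [PowerSeries.coeff_mk, hi]

/-- `T ^ m ∣ f` iff the first `m` coefficients of `f` vanish, in the `Fin m`-indexed form. [folklore] -/
theorem X_pow_dvd_iff_forall_fin (m : ℕ) (f : k⟦X⟧) :
    (X : k⟦X⟧) ^ m ∣ f ↔ ∀ i : Fin m, PowerSeries.coeff (i : ℕ) f = 0 := by
  rw [PowerSeries.X_pow_dvd_iff]
  exact ⟨fun h i => h i i.2, fun h i hi => h ⟨i, hi⟩⟩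

/-! ## §2 Finitely generated `k⟦T⟧`-modules killed by `T ^ m` are finite (`k` finite) -/

variable {M : Type v} [AddCommGroup M] [Module k⟦X⟧ M]

/-- **A finitely generated `k⟦T⟧`-module annihilated by `T ^ m` is finite** (`k` finite): with generators
`y₁, …, y_r`, every element is `∑ aᵢ • yᵢ = ∑ (aᵢ mod T^m) • yᵢ`, and there are only `#k ^ m` residues
`aᵢ mod T^m`. [folklore] -/
theorem finite_of_X_pow_smul_eq_zero [Finite k] [Module.Finite k⟦X⟧ M] (m : ℕ)
    (hM : ∀ x : M, ((X : k⟦X⟧) ^ m) • x = 0) : Finite M := by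
  obtain ⟨s, hs⟩ := (‹Module.Finite k⟦X⟧ M›).fg_top
  -- truncated lifts `k^m → k⟦T⟧`, `c ↦ ∑_{i<m} c_i T^i`
  let ℓ : (Fin m → k) → k⟦X⟧ := fun c => PowerSeries.mk fun i => if h : i < m then c ⟨i, h⟩ else 0
  let Φ : (s → (Fin m → k)) → M := fun g => ∑ y : s, ℓ (g y) • (y : M)
  refine Finite.of_surjective Φ ?_
  intro x
  have hx : x ∈ Submodule.span k⟦X⟧ (s : Set M) := by rw [hs]; exact Submodule.mem_top
  obtain ⟨a, rfl⟩ := Submodule.mem_span_finset'.mp hx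
  refine ⟨fun y i => PowerSeries.coeff (i : ℕ) (a y), ?_⟩
  refine Finset.sum_congr rfl fun y _ => ?_
  have hℓ : ℓ (fun i : Fin m => PowerSeries.coeff (i : ℕ) (a y)) =
      PowerSeries.mk (fun i => if i < m then PowerSeries.coeff i (a y) else 0) := by
    ext i
    simp only [ℓ, PowerSeries.coeff_mk]
    split_ifs <;> rfl
  obtain ⟨q, hq⟩ := X_pow_dvd_sub_mk_coeff m (a y)
  have : a y = ℓ (fun i : Fin m => PowerSeries.coeff (i : ℕ) (a y)) + (X : k⟦X⟧) ^ m * q := by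
    rw [hℓ, ← hq]; ring
  change ℓ (fun i : Fin m => PowerSeries.coeff (i : ℕ) (a y)) • (y : M) = a y • (y : M)
  conv_rhs => rw [this]
  rw [add_smul, mul_comm, mul_smul, hM, smul_zero, add_zero]

/-- **`X ⧸ T^m X` is finite** for every finitely generated `k⟦T⟧`-module `X` (`k` finite). [folklore] -/
theorem finite_quotient_X_pow_smul_top [Finite k] [Module.Finite k⟦X⟧ M] (m : ℕ) :
    Finite (M ⧸ (Ideal.span {(X : k⟦X⟧) ^ m} • (⊤ : Submodule k⟦X⟧ M))) := by
  refine finite_of_X_pow_smul_eq_zero (k := k) m fun x => ?_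
  induction x using Submodule.Quotient.induction_on with
  | H x =>
    rw [← Submodule.Quotient.mk_smul, Submodule.Quotient.mk_eq_zero]
    exact Submodule.smul_mem_smul (Ideal.mem_span_singleton_self _) Submodule.mem_top

/-! ## §3 The criterion -/

/-- **A finitely generated NON-torsion module over `k⟦T⟧` surjects onto `k⟦T⟧`**: its torsion-free quotient is
free (PID) of positive rank, and a coordinate function is onto. [folklore] -/
theorem exists_surjective_of_not_isTorsion [Module.Finite k⟦X⟧ M]
    (hM : ¬ Module.IsTorsion k⟦X⟧ M) :
    ∃ ψ : M →ₗ[k⟦X⟧] k⟦X⟧, Function.Surjective ψ := by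
  -- the torsion-free quotient `Q = M ⧸ torsion` is finite free over the PID `k⟦T⟧`
  set N := Submodule.torsion k⟦X⟧ M with hN
  haveI : Module.Finite k⟦X⟧ (M ⧸ N) := inferInstance
  haveI : Module.IsTorsionFree k⟦X⟧ (M ⧸ N) := Submodule.QuotientTorsion.instIsTorsionFree
  haveI : Module.Free k⟦X⟧ (M ⧸ N) := Module.free_of_finite_type_torsion_free'
  -- it is nonzero, since `M` is not torsion
  have hQ : Nontrivial (M ⧸ N) := by
    by_contra hsub
    rw [not_nontrivial_iff_subsingleton] at hsub
    apply hM
    intro x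
    have hx : x ∈ N := by
      rw [← Submodule.Quotient.mk_eq_zero]
      exact Subsingleton.elim _ _
    exact hx
  let b := Module.Free.chooseBasis k⟦X⟧ (M ⧸ N)
  haveI : Nonempty (Module.Free.ChooseBasisIndex k⟦X⟧ (M ⧸ N)) := b.index_nonempty
  obtain ⟨i⟩ := ‹Nonempty (Module.Free.ChooseBasisIndex k⟦X⟧ (M ⧸ N))›
  refine ⟨(b.coord i).comp N.mkQ, ?_⟩
  intro r
  refine ⟨(N.mkQ).toFun.surjInv N.mkQ_surjective (r • b i), ?_⟩
  simp only [LinearMap.coe_comp, Function.comp_apply]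
  rw [show N.mkQ (Function.surjInv N.mkQ_surjective (r • b i)) = r • b i from
    Function.surjInv_eq N.mkQ_surjective _]
  simp

/-- The cardinality of `k⟦T⟧ ⧸ T^m`: `#k ^ m` (first `m` coefficients). [folklore] -/
theorem natCard_quotient_X_pow [Finite k] (m : ℕ) :
    Nat.card (k⟦X⟧ ⧸ Ideal.span {(X : k⟦X⟧) ^ m}) = Nat.card k ^ m := by
  let I : Ideal k⟦X⟧ := Ideal.span {(X : k⟦X⟧) ^ m}
  -- the first `m` coefficients, a `k`-linear map `k⟦T⟧ → k^m` with kernel `(T^m)`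
  let τ : k⟦X⟧ →ₗ[k] (Fin m → k) := LinearMap.pi fun i : Fin m => PowerSeries.coeff (R := k) (i : ℕ)
  have hτ : ∀ f : k⟦X⟧, τ f = 0 ↔ (X : k⟦X⟧) ^ m ∣ f := by
    intro f
    rw [X_pow_dvd_iff_forall_fin]
    exact ⟨fun h i => congr_fun h i, fun h => funext h⟩
  have hker : I.restrictScalars k ≤ LinearMap.ker τ := by
    intro f hf
    rw [LinearMap.mem_ker, hτ]
    exact Ideal.mem_span_singleton.mp hf
  let θ : (k⟦X⟧ ⧸ I.restrictScalars k) →ₗ[k] (Fin m → k) := (I.restrictScalars k).liftQ τ hker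
  have hθ : Function.Bijective θ := by
    constructor
    · rw [← LinearMap.ker_eq_bot, LinearMap.ker_eq_bot']
      intro x hx
      induction x using Submodule.Quotient.induction_on with
      | H f =>
        rw [Submodule.liftQ_apply] at hx
        rw [Submodule.Quotient.mk_eq_zero, Submodule.restrictScalars_mem, Ideal.mem_span_singleton, ← hτ]
        exact hx
    · intro c
      refine ⟨Submodule.Quotient.mk (PowerSeries.mk fun i => if h : i < m then c ⟨i, h⟩ else 0), ?_⟩
      rw [Submodule.liftQ_apply]
      ext i
      simp [τ, PowerSeries.coeff_mk, i.2]
  have e : (k⟦X⟧ ⧸ I.restrictScalars k) ≃ₗ[k] (k⟦X⟧ ⧸ I) := Submodule.Quotient.restrictScalarsEquiv k I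
  calc Nat.card (k⟦X⟧ ⧸ I) = Nat.card (k⟦X⟧ ⧸ I.restrictScalars k) := Nat.card_congr e.toEquiv.symm
    _ = Nat.card (Fin m → k) := Nat.card_congr (Equiv.ofBijective θ hθ)
    _ = Nat.card k ^ m := by rw [Nat.card_fun, Nat.card_eq_fintype_card (α := Fin m), Fintype.card_fin]

/-- **If `X` is not torsion then `#(X ⧸ T^m X) ≥ #k ^ m`**: a surjection `X ↠ Ω` induces
`X ⧸ T^m X ↠ Ω ⧸ T^m`. [folklore] -/
theorem pow_le_natCard_quotient_of_not_isTorsion [Finite k] [Module.Finite k⟦X⟧ M] (m : ℕ)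
    (hM : ¬ Module.IsTorsion k⟦X⟧ M) :
    Nat.card k ^ m ≤ Nat.card (M ⧸ (Ideal.span {(X : k⟦X⟧) ^ m} • (⊤ : Submodule k⟦X⟧ M))) := by
  obtain ⟨ψ, hψ⟩ := exists_surjective_of_not_isTorsion hM
  let I : Ideal k⟦X⟧ := Ideal.span {(X : k⟦X⟧) ^ m}
  -- `ψ` maps `T^m X` into `T^m Ω = (T^m)`
  have hle : I • (⊤ : Submodule k⟦X⟧ M) ≤ Submodule.comap ψ (I.restrictScalars k⟦X⟧) := by
    rw [← Submodule.map_le_iff_le_comap, Submodule.map_smul'']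
    refine (Submodule.smul_mono le_rfl le_top).trans ?_
    intro f hf
    rw [Submodule.restrictScalars_mem]
    have : I • (⊤ : Submodule k⟦X⟧ k⟦X⟧) = I := by
      rw [Ideal.smul_eq_mul, Ideal.mul_top]
    rw [← this]
    exact hf
  let θ := Submodule.mapQ (I • (⊤ : Submodule k⟦X⟧ M)) (I.restrictScalars k⟦X⟧) ψ hle
  have hθ : Function.Surjective θ := by
    intro y
    induction y using Submodule.Quotient.induction_on with
    | H f =>
      obtain ⟨x, rfl⟩ := hψ f
      exact ⟨Submodule.Quotient.mk x, by rw [Submodule.mapQ_apply]⟩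
  haveI : Finite (M ⧸ (I • (⊤ : Submodule k⟦X⟧ M))) := finite_quotient_X_pow_smul_top m
  have e : (k⟦X⟧ ⧸ I.restrictScalars k⟦X⟧) = (k⟦X⟧ ⧸ I) := rfl
  calc Nat.card k ^ m = Nat.card (k⟦X⟧ ⧸ I) := (natCard_quotient_X_pow m).symm
    _ = Nat.card (k⟦X⟧ ⧸ I.restrictScalars k⟦X⟧) := by rw [Submodule.restrictScalars_self]
    _ ≤ Nat.card (M ⧸ (I • (⊤ : Submodule k⟦X⟧ M))) := Nat.card_le_card_of_surjective θ hθ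

/-- **A finitely generated torsion `k⟦T⟧`-module is finite** (`k` finite): a common annihilator `a ≠ 0`
is `T^d · unit`, so `T^d` kills the module. [folklore] -/
theorem finite_of_isTorsion [Finite k] [Module.Finite k⟦X⟧ M] (hM : Module.IsTorsion k⟦X⟧ M) :
    Finite M := by
  obtain ⟨a, ha, ha0⟩ := Submodule.annihilator_top_inter_nonZeroDivisors hM
  have hane : (a : k⟦X⟧) ≠ 0 := nonZeroDivisors.ne_zero ha0
  -- `a = T^d · u` with `u` a unit
  have hdec : (X : k⟦X⟧) ^ a.order.toNat * divXPowOrder a = a := X_pow_order_mul_divXPowOrder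
  obtain ⟨u, hu⟩ := isUnit_divided_by_X_pow_order hane
  refine finite_of_X_pow_smul_eq_zero (k := k) a.order.toNat fun x => ?_
  have hax : a • x = 0 := Submodule.mem_annihilator.mp ha x Submodule.mem_top
  have : (X : k⟦X⟧) ^ a.order.toNat = (↑u⁻¹ : k⟦X⟧) * a :=
    calc (X : k⟦X⟧) ^ a.order.toNat = (X : k⟦X⟧) ^ a.order.toNat * ((u : k⟦X⟧) * (↑u⁻¹ : k⟦X⟧)) := by
          rw [Units.mul_inv, mul_one]
      _ = (X : k⟦X⟧) ^ a.order.toNat * (u : k⟦X⟧) * (↑u⁻¹ : k⟦X⟧) := by rw [mul_assoc]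
      _ = a * (↑u⁻¹ : k⟦X⟧) := by rw [hu, hdec]
      _ = (↑u⁻¹ : k⟦X⟧) * a := mul_comm _ _
  rw [this, mul_smul, hax, smul_zero]

/-- **THE ONE-LAYER CRITERION.** A finitely generated `k⟦T⟧`-module `X` (`k` finite) with `#(X ⧸ T^m X) < #k ^ m`
for SOME `m` is finite: by `pow_le_natCard_quotient_of_not_isTorsion` it is torsion, and finitely generated
torsion modules over `k⟦T⟧` are finite. [folklore] -/
theorem finite_of_natCard_quotient_lt [Finite k] [Module.Finite k⟦X⟧ M] (m : ℕ)
    (h : Nat.card (M ⧸ (Ideal.span {(X : k⟦X⟧) ^ m} • (⊤ : Submodule k⟦X⟧ M))) < Nat.card k ^ m) :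
    Finite M := by
  by_cases hM : Module.IsTorsion k⟦X⟧ M
  · exact finite_of_isTorsion hM
  · exact absurd h (not_lt.mpr (pow_le_natCard_quotient_of_not_isTorsion m hM))

/-- **`OmegaLayerCriterion` (crux idea `residual-layer-criterion` on stmt-BirchSwinnertonDyer-24254, stub S-B1), VERBATIM
shape**: a finitely generated `𝔽₃⟦T⟧`-module `X` with `#(X ⧸ T^{3^n} X) < 3^{3^n}` for some `n` is finite. [folklore] -/
theorem omegaLayerCriterion :
    ∀ (X : Type) [AddCommGroup X] [Module (PowerSeries (ZMod 3)) X] [Module.Finite (PowerSeries (ZMod 3)) X]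
      (n : ℕ),
      Nat.card (X ⧸ (Ideal.span {(PowerSeries.X ^ (3 ^ n) : PowerSeries (ZMod 3))} •
          (⊤ : Submodule (PowerSeries (ZMod 3)) X))) < 3 ^ (3 ^ n) →
      Finite X := by
  intro X _ _ _ n h
  haveI : Fact (Nat.Prime 3) := ⟨Nat.prime_three⟩
  refine finite_of_natCard_quotient_lt (k := ZMod 3) (3 ^ n) ?_
  rwa [Nat.card_zmod]

end Summit.BirchSwinnertonDyer.BirchSwinnertonDyer.Theorems.UniversalToricDescentResidualLayerAlgebra

end
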